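import Summits.HodgeConjecture.HodgeConjecture.Theorems.MarkmanPartnerTransportSymmetricFormOfDualClass
import HarnessLib

/-!
# Route MarkmanPartnerTransport · support #3 `IsometrySpannedThird` BY NAME, at every Picard rank, from THREE
# published facts: Verbitsky–Guan (cohomology of `K3^{[2]}`-type), Charles–Markman (`B(X)` for `K3^{[n]}`-type)
# and Markman 2024 (rational Hodge isometries are algebraic) — task W-QX3 of the cell hodge-nonav, part 2 of 2

The chain `exists_algebraicClass_of_symmetricForm` → `mem_algebraicClasses_two_of_spannedByIsometries_of_graphClasses`
→ `isometrySpannedThird_of_graphClasses` → `…_of_kappaClasses` → `…_of_qInvAlgebraic` (files `…ScalarAllRanks`,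
`…OfGraphClasses(Route)`, `…KappaClasses`, `…KappaClassesOfQInverse`) consumes `OGrady2008_dualBBFClass_algebraic`
only through its first clause `q^∨ ∈ A²(X)`, a THEOREM of the tree granted `B(X)` and `b₃ = 0`
(`dualBBFClass_mem_algebraicClasses_of_lefschetzStandard`). Part 1 (`…SymmetricFormOfDualClass`) re-ran the
first link on the weak clause; this file re-runs `mem_algebraicClasses_two_of_spannedByIsometries_of_graphClasses`
(append-only copy `…_of_dualClass`, same proof, one line changed) and composes with the `hO`-free links
`graphClasses_of_kappaClasses`, `kappaClasses_of_qInvAlgebraic`, `qInvAlgebraic_of_charlesMarkman`: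

* `isometrySpannedThird_of_three_facts (hV) (hB) (hMk)` — **item #3 `IsometrySpannedThird`
  (stmt-HodgeConjecture-19651) BY NAME modulo exactly {`VerbitskyGuan_cohomology_K3HilbertSquareType`,
  `CharlesMarkman2013_lefschetzStandard_K3HilbertType`, `Markman2024_rationalHodgeIsometry_algebraic_marked`}** —
  three named facts (published theorems) instead of the four of `isometrySpannedThird_of_lefschetzStandard_of_markman`;
  no partner surface, no Picard-rank hypothesis.

CONDITIONAL; credits nothing; nothing here says HC is proved; rung F-H1 not moved. No definition, no sorry.
Seat 20241-p1 g12; p1 g35 ruling 2026-08-28T06:05:10Z.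

References: F. Charles, E. Markman, Compos. Math. 149 (2013) Thm. 1.1; E. Markman, Compos. Math. 160 (2024)
Thm. 1.1; K. O'Grady, *Mat. Contemp.* (2008) §3; M. Verbitsky (1996) / D. Guan (2001); S. Novario, Kyoto J. Math.
66 (2026) Thm. 6.2; Yu. Zarhin, J. reine angew. Math. 341 (1983) Thm. 1.5.1.
-/

noncomputable section

set_option linter.dupNamespace false

open Module CategoryTheory
open Literature.AlgebraicTopology.SingularHomology Literature.Geometry.Kaehler
open Literature.AlgebraicGeometry Literature.AlgebraicGeometry.Motives Literature.AlgebraicGeometry.HodgeTheory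
open Literature.AlgebraicGeometry.Hyperkaehler Literature.AlgebraicGeometry.Surfaces
open Summit.HodgeConjecture.HodgeConjecture.Theorems.NikulinTwinTransport
open Summit.HodgeConjecture.HodgeConjecture.Theorems.MarkmanPartnerTransport.BBFPositivity

namespace Summit.HodgeConjecture.HodgeConjecture.Theorems.MarkmanPartnerTransport.PartnerLattice

/-- `MarkedK3Sq[X, φ, P, z]`: VERBATIM the `let MarkedK3Sq := …` binder of the route declarations of
MarkmanPartnerTransport (clauses (m1)–(m6)). Local notation only. -/
local notation3 (prettyPrint := false) "MarkedK3Sq[" X ", " φ ", " P ", " z "]" =>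
  (((IsIntegralClass P ∧ ∀ Q : complexBetti X (2 * 4), IsIntegralClass Q → ∃ n : ℤ, Q = n • P) ∧
    (∀ c : complexBetti X 2, IsIntegralClass c ↔ ∃ v : K3HilbertIndex → ℤ, φ c = fun i => (v i : ℂ)) ∧
    (∀ a : complexBetti X 2, cupPowTwo a 4 = ((3 : ℂ) * (k3HilbertForm 2 (φ a) (φ a)) ^ 2) • P) ∧
    (IsOfHodgeType 4 X 2 2 0 (LinearEquiv.symm φ z) ∧
      ∀ τ : complexBetti X 2, IsOfHodgeType 4 X 2 2 0 τ → ∃ t : ℂ, τ = t • LinearEquiv.symm φ z) ∧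
    (∀ c : complexBetti X 2, IsOfHodgeType 4 X 2 1 1 c ↔
      (k3HilbertForm 2 (φ c) z = 0 ∧ k3HilbertForm 2 (φ c) (star z) = 0)) ∧
    (k3HilbertForm 2 z z = 0 ∧ 0 < (k3HilbertForm 2 (star z) z).re)))

/-- `Cup3[c, y, w] = (c ∪ y) ∪ w ∈ H⁸` for `c ∈ H⁴`, `y, w ∈ H²`. Local notation only. -/
local notation3 (prettyPrint := false) "Cup3[" c ", " y ", " w "]" =>
  cupProduct (rfl : 2 * 3 + 2 = 2 * 4) (cupProduct (rfl : 2 * 2 + 2 = 2 * 3) c y) w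

variable {X : SchemeOver ℂ} {φ : complexBetti X 2 ≃ₗ[ℂ] (K3HilbertIndex → ℂ)} {P : complexBetti X (2 * 4)}
  {z : K3HilbertIndex → ℂ}

/-- `SpannedByIso[X, φ]`: VERBATIM the `let SpannedByIsometries := …` binder of the route declarations (with
`IsBBFTransc` inlined). Local notation only. -/
local notation3 (prettyPrint := false) "SpannedByIso[" X ", " φ "]" =>
  ∀ f : complexBetti X 2 →ₗ[ℂ] complexBetti X 2, (∀ y, IsRationalClass y → IsRationalClass (f y)) →
    (∀ (i j : ℕ) y, IsOfHodgeType 4 X 2 i j y → IsOfHodgeType 4 X 2 i j (f y)) →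
    (∀ d : complexBetti X 2, d ∈ algebraicClasses X 1 → f d = 0) →
    (∀ y : complexBetti X 2, ∀ d : complexBetti X 2, d ∈ algebraicClasses X 1 →
      k3HilbertForm 2 (φ (f y)) (φ d) = 0) →
    ∃ (k : ℕ) (c : Fin k → ℚ) (g : Fin k → (complexBetti X 2 →ₗ[ℂ] complexBetti X 2)),
      (∀ i, Function.Bijective (g i) ∧ (∀ y, IsRationalClass y → IsRationalClass (g i y)) ∧
        (∀ (a b : ℕ) y, IsOfHodgeType 4 X 2 a b y → IsOfHodgeType 4 X 2 a b (g i y)) ∧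
        (∀ a b, k3HilbertForm 2 (φ (g i a)) (φ (g i b)) = k3HilbertForm 2 (φ a) (φ b))) ∧
      ∀ y : complexBetti X 2, (∀ d : complexBetti X 2, d ∈ algebraicClasses X 1 →
        k3HilbertForm 2 (φ y) (φ d) = 0) → f y = ∑ i : Fin k, ((c i : ℂ) • g i y)

/-- `Graph[X, φ, P]`: the geometric input — for every bijective rational Hodge `q`-isometry `g` of `H²(X)` an
ALGEBRAIC class `c_g ∈ A²(X)` and `t ∈ ℂ` with `(c_g ∪ y) ∪ w = (t·q(y,w) + q(gy,w) + q(gw,y))·P`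
(intended: `c_g = Δ^*(Γ_g ∘ q⁻¹)`, `t = tr g`; Markman 2024 + Charles–Markman 2013). Local notation only. -/
local notation3 (prettyPrint := false) "Graph[" X ", " φ ", " P "]" =>
  ∀ g : complexBetti X 2 →ₗ[ℂ] complexBetti X 2, Function.Bijective g →
    (∀ y, IsRationalClass y → IsRationalClass (g y)) →
    (∀ (a b : ℕ) y, IsOfHodgeType 4 X 2 a b y → IsOfHodgeType 4 X 2 a b (g y)) →
    (∀ a b, k3HilbertForm 2 (φ (g a)) (φ (g b)) = k3HilbertForm 2 (φ a) (φ b)) →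
    ∃ cg ∈ algebraicClasses X 2, ∃ t : ℂ, ∀ y w : complexBetti X 2,
      Cup3[cg, y, w] = (t * k3HilbertForm 2 (φ y) (φ w) + k3HilbertForm 2 (φ (g y)) (φ w) +
        k3HilbertForm 2 (φ (g w)) (φ y)) • P

/-! ### §2 The isometry third modulo the graph classes, on the weak clause -/

/-- **The isometry third at every Picard rank, modulo the graph classes — on the weak clause `q^∨ ∈ A²(X)`**
(copy of `mem_algebraicClasses_two_of_spannedByIsometries_of_graphClasses` with `hO` replaced by `hqd`).
[cite: Markman2024, §1.1 Thm. 1.1] [cite: Zarhin1983HodgeGroupsK3, Thm. 1.5.1]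
[cite: Novario2026HodgeClassesHilbertSquares, Thm. 6.2] [cite: OGrady2008NumericalK3Square, §3] -/
theorem mem_algebraicClasses_two_of_spannedByIsometries_of_graphClasses_of_dualClass
    (hV : VerbitskyGuan_cohomology_K3HilbertSquareType) (hcup : Voisin2003_cupProduct_algebraicClasses)
    (hX : IsSmoothProjective 4 X) (hK : IsOfK3HilbertSquareType X) (hM : MarkedK3Sq[X, φ, P, z])
    (hqd : dualBBFClass 2 φ ∈ algebraicClasses X 2)
    (hSp : SpannedByIso[X, φ]) (hGraph : Graph[X, φ, P]) {c : complexBetti X (2 * 2)}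
    (hcrat : IsRationalClass c) (hc22 : IsOfHodgeType 4 X (2 * 2) 2 2 c) : c ∈ algebraicClasses X 2 := by
  classical
  obtain ⟨F, hF⟩ := exists_classEndomorphism hX hM c
  have hFadj : ∀ y w, k3HilbertForm 2 (φ (F y)) (φ w) = k3HilbertForm 2 (φ y) (φ (F w)) :=
    classEndomorphism_selfAdjoint hX hM hF
  obtain ⟨πT, hT1, hT2, hT3, hT4, hT5, hT6, hT7⟩ := exists_transcendentalProjector hX hM
  obtain ⟨hfrat, hfh, hfN, hfT, hfadj, hsplitF⟩ :=
    classEndomorphism_transcendentalPart hX hM hcrat hc22 hF hT1 hT3 hT4 hT5 hT6 hT7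
  have hNT : ∀ n ∈ algebraicClasses X 1, ∀ w, k3HilbertForm 2 (φ n) (φ (πT w)) = 0 := fun n hn w => by
    rw [k3HilbertForm_comm]; exact hT3 w n hn
  have hN11 : ∀ d ∈ algebraicClasses X 1, IsOfHodgeType 4 X 2 1 1 d := fun d hd =>
    isOfHodgeType_of_mem_algebraicClasses_of_isSmoothProjective hX 1 hd
  -- `SpannedByIsometries` applied to `f = πT F πT`
  obtain ⟨k, cc, g, hg, hfsum⟩ := hSp (πT ∘ₗ F ∘ₗ πT)
    (fun y hy => by rw [LinearMap.comp_apply, LinearMap.comp_apply]; exact hfrat y hy)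
    (fun i j y hy => by rw [LinearMap.comp_apply, LinearMap.comp_apply]; exact hfh i j y hy)
    (fun d hd => by rw [LinearMap.comp_apply, LinearMap.comp_apply]; exact hfN d hd)
    (fun y d hd => by rw [LinearMap.comp_apply, LinearMap.comp_apply]; exact hfT y d hd)
  have hfy : ∀ y, πT (F (πT y)) = ∑ i, (cc i : ℂ) • g i (πT y) := fun y => by
    have := hfsum (πT y) (hT3 y)
    rwa [LinearMap.comp_apply, LinearMap.comp_apply, hT2 (πT y) (hT3 y)] at this
  -- the `gᵢ` preserve `N¹(X)` (Lefschetz `(1,1)`)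
  have hgN : ∀ i, ∀ d ∈ algebraicClasses X 1, g i d ∈ algebraicClasses X 1 := by
    have hspan := supportedClasses_eq_span_isRationalClass hX 2 1
    change algebraicClasses X 1 = Submodule.span ℂ
      {c : complexBetti X 2 | IsRationalClass c ∧ c ∈ algebraicClasses X 1} at hspan
    intro i d hd
    rw [hspan] at hd
    have hle : Submodule.span ℂ {c : complexBetti X 2 | IsRationalClass c ∧ c ∈ algebraicClasses X 1} ≤
        (algebraicClasses X 1).comap (g i) := by
      refine Submodule.span_le.2 ?_
      rintro d ⟨hdrat, hdalg⟩
      exact lefschetzOneOne_rational_holds hX _ ((hg i).2.1 _ hdrat) ((hg i).2.2.1 1 1 _ (hN11 d hdalg))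
    exact hle hd
  -- bilinear bookkeeping
  set qXform : LinearMap.BilinForm ℂ (complexBetti X 2) :=
    (Matrix.toBilin' (Matrix.map (k3HilbertGram 2) (Int.cast : ℤ → ℂ))).compl₁₂
      (φ : complexBetti X 2 →ₗ[ℂ] (K3HilbertIndex → ℂ)) (φ : complexBetti X 2 →ₗ[ℂ] (K3HilbertIndex → ℂ))
    with hqXform
  have hqXapp : ∀ y w, qXform y w = k3HilbertForm 2 (φ y) (φ w) := fun y w => by
    rw [hqXform, LinearMap.compl₁₂_apply, qC_apply]; rfl
  have hqsub : ∀ a b w : complexBetti X 2, k3HilbertForm 2 (φ (a - b)) (φ w) =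
      k3HilbertForm 2 (φ a) (φ w) - k3HilbertForm 2 (φ b) (φ w) := fun a b w => by
    rw [← hqXapp, ← hqXapp, ← hqXapp, map_sub, LinearMap.sub_apply]
  -- `q(gᵢ (πT y), w) = q(gᵢ y, w) − q(gᵢ y_N, w_N)`
  have hgsplit : ∀ i y w, k3HilbertForm 2 (φ (g i (πT y))) (φ w) =
      k3HilbertForm 2 (φ (g i y)) (φ w) - k3HilbertForm 2 (φ (g i (y - πT y))) (φ (w - πT w)) := by
    intro i y w
    have e1 : g i (πT y) = g i y - g i (y - πT y) := by rw [map_sub]; abel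
    have hw : w = (w - πT w) + πT w := by abel
    have e2 : k3HilbertForm 2 (φ (g i (y - πT y))) (φ w) =
        k3HilbertForm 2 (φ (g i (y - πT y))) (φ (w - πT w)) := by
      conv_lhs => rw [hw, map_add, k3HilbertForm_add_right, hNT _ (hgN i _ (hT4 y)) w, add_zero]
    rw [e1, hqsub, e2]
  -- `q(f y, w) = Σ cᵢ (q(gᵢ y, w) − q(gᵢ y_N, w_N))`
  have hqf : ∀ y w, k3HilbertForm 2 (φ (πT (F (πT y)))) (φ w) = ∑ i, (cc i : ℂ) *
      (k3HilbertForm 2 (φ (g i y)) (φ w) - k3HilbertForm 2 (φ (g i (y - πT y))) (φ (w - πT w))) := by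
    intro y w
    rw [← hqXapp, hfy, map_sum, LinearMap.sum_apply]
    refine Finset.sum_congr rfl fun i _ => ?_
    rw [map_smul, LinearMap.smul_apply, smul_eq_mul, hqXapp, hgsplit]
  -- the symmetric correction form `β` on `N¹(X)`
  set B : complexBetti X 2 →ₗ[ℂ] complexBetti X 2 →ₗ[ℂ] ℂ :=
    qXform.compl₁₂ F LinearMap.id - ∑ i, (cc i : ℂ) • qXform.compl₁₂ (g i) LinearMap.id with hBraw
  have hBdef : ∀ u v, B u v = k3HilbertForm 2 (φ (F u)) (φ v) -
      ∑ i, (cc i : ℂ) * k3HilbertForm 2 (φ (g i u)) (φ v) := by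
    intro u v
    rw [hBraw, LinearMap.sub_apply, LinearMap.sub_apply, LinearMap.compl₁₂_apply, LinearMap.id_apply, hqXapp,
      LinearMap.sum_apply, LinearMap.sum_apply]
    congr 1
    refine Finset.sum_congr rfl fun i _ => ?_
    rw [LinearMap.smul_apply, LinearMap.smul_apply, LinearMap.compl₁₂_apply, LinearMap.id_apply, hqXapp,
      smul_eq_mul]
  clear_value B
  set β : complexBetti X 2 →ₗ[ℂ] complexBetti X 2 →ₗ[ℂ] ℂ := (1 / 2 : ℂ) • (B + B.flip) with hβraw
  have hβdef : ∀ u v, β u v = 1 / 2 * (B u v + B v u) := fun u v => by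
    rw [hβraw, LinearMap.smul_apply, LinearMap.smul_apply, LinearMap.add_apply, LinearMap.add_apply,
      LinearMap.flip_apply, smul_eq_mul]
  clear_value β
  have hβsymm : ∀ u v, β u v = β v u := fun u v => by rw [hβdef, hβdef, add_comm]
  have hqr : ∀ n ∈ algebraicClasses X 1, ∀ y : complexBetti X 2,
      k3HilbertForm 2 (φ n) (φ (y - πT y)) = k3HilbertForm 2 (φ n) (φ y) := by
    intro n hn y
    rw [map_sub, sub_eq_add_neg, k3HilbertForm_add_right, ← neg_one_smul ℂ, k3HilbertForm_smul_right,
      hNT n hn y, mul_zero, add_zero]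
  -- the graph classes and the candidate
  choose cg hcgalg t hcg using fun i => hGraph (g i) (hg i).1 (hg i).2.1 (hg i).2.2.1 (hg i).2.2.2
  obtain ⟨c', hc'alg, hc'⟩ := exists_algebraicClass_of_symmetricForm_of_dualClass hcup hX hM hqd
    (-(∑ i, (cc i : ℂ) / 2 * t i)) β hβsymm (fun y => y - πT y) hT4 hqr
  obtain ⟨c'', hc''def⟩ : ∃ c'' : complexBetti X (2 * 2), c'' = (∑ i, ((cc i : ℂ) / 2) • cg i) + c' :=
    ⟨_, rfl⟩
  have hc''alg : c'' ∈ algebraicClasses X 2 := by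
    rw [hc''def]
    exact Submodule.add_mem _ (Submodule.sum_mem _ fun i _ => Submodule.smul_mem _ _ (hcgalg i)) hc'alg
  have hcup3 : ∀ y w : complexBetti X 2, Cup3[c, y, w] = Cup3[c'', y, w] := by
    intro y w
    have hL1 : ∀ A A' : complexBetti X (2 * 2), Cup3[A + A', y, w] = Cup3[A, y, w] + Cup3[A', y, w] := by
      intro A A'; simp only [map_add, LinearMap.add_apply]
    have hL2 : ∀ (u : ℂ) (A : complexBetti X (2 * 2)), Cup3[u • A, y, w] = u • Cup3[A, y, w] := by
      intro u A; simp only [map_smul, LinearMap.smul_apply]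
    have hL3 : ∀ A : Fin k → complexBetti X (2 * 2), Cup3[∑ i, A i, y, w] = ∑ i, Cup3[A i, y, w] := by
      intro A; simp only [map_sum, LinearMap.sum_apply]
    have hrhs : Cup3[c'', y, w] = ((∑ i, (cc i : ℂ) / 2 * (t i * k3HilbertForm 2 (φ y) (φ w) +
        k3HilbertForm 2 (φ (g i y)) (φ w) + k3HilbertForm 2 (φ (g i w)) (φ y))) +
        (-(∑ i, (cc i : ℂ) / 2 * t i) * k3HilbertForm 2 (φ y) (φ w) + β (y - πT y) (w - πT w))) • P := by
      rw [hc''def, hL1, hL3, hc']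
      conv_rhs => rw [add_smul, Finset.sum_smul]
      congr 1
      refine Finset.sum_congr rfl fun i _ => ?_
      rw [hL2, hcg, smul_smul]
    rw [hF, hrhs]
    congr 1
    -- the scalar identity, on the atoms `SA, SB, SAN, SBN, ST, q(y,w), q(F y_N, w_N)`
    have h1 : ∑ i, (cc i : ℂ) / 2 * (t i * k3HilbertForm 2 (φ y) (φ w) +
        k3HilbertForm 2 (φ (g i y)) (φ w) + k3HilbertForm 2 (φ (g i w)) (φ y)) =
        (∑ i, (cc i : ℂ) / 2 * t i) * k3HilbertForm 2 (φ y) (φ w) +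
          1 / 2 * ∑ i, (cc i : ℂ) * k3HilbertForm 2 (φ (g i y)) (φ w) +
          1 / 2 * ∑ i, (cc i : ℂ) * k3HilbertForm 2 (φ (g i w)) (φ y) := by
      rw [Finset.sum_mul, Finset.mul_sum, Finset.mul_sum, ← Finset.sum_add_distrib, ← Finset.sum_add_distrib]
      exact Finset.sum_congr rfl fun i _ => by ring
    have h2 : ∀ u v : complexBetti X 2, ∑ i, (cc i : ℂ) * (k3HilbertForm 2 (φ (g i u)) (φ v) -
        k3HilbertForm 2 (φ (g i (u - πT u))) (φ (v - πT v))) =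
        ∑ i, (cc i : ℂ) * k3HilbertForm 2 (φ (g i u)) (φ v) -
          ∑ i, (cc i : ℂ) * k3HilbertForm 2 (φ (g i (u - πT u))) (φ (v - πT v)) := fun u v => by
      rw [← Finset.sum_sub_distrib]
      exact Finset.sum_congr rfl fun i _ => by ring
    have hfw : k3HilbertForm 2 (φ (πT (F (πT w)))) (φ y) = k3HilbertForm 2 (φ (πT (F (πT y)))) (φ w) := by
      rw [hfadj w y, k3HilbertForm_comm]
    have key : k3HilbertForm 2 (φ (πT (F (πT y)))) (φ w) =
        1 / 2 * (∑ i, (cc i : ℂ) * k3HilbertForm 2 (φ (g i y)) (φ w) -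
          ∑ i, (cc i : ℂ) * k3HilbertForm 2 (φ (g i (y - πT y))) (φ (w - πT w))) +
        1 / 2 * (∑ i, (cc i : ℂ) * k3HilbertForm 2 (φ (g i w)) (φ y) -
          ∑ i, (cc i : ℂ) * k3HilbertForm 2 (φ (g i (w - πT w))) (φ (y - πT y))) := by
      rw [← h2, ← h2, ← hqf y w, ← hqf w y, hfw]; ring
    have hQF : k3HilbertForm 2 (φ (F (w - πT w))) (φ (y - πT y)) =
        k3HilbertForm 2 (φ (F (y - πT y))) (φ (w - πT w)) := by rw [hFadj, k3HilbertForm_comm]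
    rw [hsplitF y w, key, h1, hβdef, hBdef, hBdef, hQF]
    ring
  exact eq_of_cup3_eq hV hX hK hcup3 ▸ hc''alg

/-! ### §3 Composition: item #3 by name from three facts -/

/-- **`IsometrySpannedThird` by name from the graph classes, on the weak clause** (copy of
`isometrySpannedThird_of_graphClasses`; the other degrees by Lefschetz `(1,1)` and hard Lefschetz).
[cite: Markman2024, §1.1 Thm. 1.1] [cite: VoisinHodgeI2002, Thm. 11.30 and Thm. 6.25] -/
theorem isometrySpannedThird_of_graphClasses_of_dualClass
    (hV : VerbitskyGuan_cohomology_K3HilbertSquareType) (hcup : Voisin2003_cupProduct_algebraicClasses)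
    (hqd : ∀ (X : SchemeOver ℂ), IsSmoothProjective 4 X → IsOfK3HilbertSquareType X →
      ∀ (φ : complexBetti X 2 ≃ₗ[ℂ] (K3HilbertIndex → ℂ)) (P : complexBetti X (2 * 4)) (z : K3HilbertIndex → ℂ),
      MarkedK3Sq[X, φ, P, z] → dualBBFClass 2 φ ∈ algebraicClasses X 2)
    (hGraph : ∀ (X : SchemeOver ℂ), IsSmoothProjective 4 X → IsOfK3HilbertSquareType X →
      ∀ (φ : complexBetti X 2 ≃ₗ[ℂ] (K3HilbertIndex → ℂ)) (P : complexBetti X (2 * 4)) (z : K3HilbertIndex → ℂ),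
      MarkedK3Sq[X, φ, P, z] → Graph[X, φ, P]) :
    Summit.HodgeConjecture.HodgeConjecture.Theses.MarkmanPartnerTransport.IsometrySpannedThird := by
  delta Summit.HodgeConjecture.HodgeConjecture.Theses.MarkmanPartnerTransport.IsometrySpannedThird
  intro _ _ _ X hX hK φ P z hM hSp
  exact ⟨nonempty_hodgeModel_holds hX, fun p c hc hH ↦
    hodgeClasses_algebraic_fourfold_of_hodgeTwoTwo lefschetzOneOne_rational_holds
      (nonempty_hardLefschetzNFold_holds 4 X) hX
      (fun _ hc' hH' ↦ mem_algebraicClasses_two_of_spannedByIsometries_of_graphClasses_of_dualClass hV hcup hX hK hM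
        (hqd X hX hK φ P z hM) hSp (hGraph X hX hK φ P z hM) hc' hH')
      p c hc hH⟩

/-- **`IsometrySpannedThird` by name from `QInvAlgebraic`, Markman 2024 and the weak clause** (the steps
`kappaClasses_of_qInvAlgebraic` and `graphClasses_of_kappaClasses` of the tree are `hO`-free).
[cite: Markman2024, Thm. 1.1 (§1.1)] [cite: OGrady2008NumericalK3Square, §2.1 (2.1.2)] -/
theorem isometrySpannedThird_of_qInvAlgebraic_of_dualClass
    (hV : VerbitskyGuan_cohomology_K3HilbertSquareType) (hcup : Voisin2003_cupProduct_algebraicClasses)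
    (hqd : ∀ (X : SchemeOver ℂ), IsSmoothProjective 4 X → IsOfK3HilbertSquareType X →
      ∀ (φ : complexBetti X 2 ≃ₗ[ℂ] (K3HilbertIndex → ℂ)) (P : complexBetti X (2 * 4)) (z : K3HilbertIndex → ℂ),
      MarkedK3Sq[X, φ, P, z] → dualBBFClass 2 φ ∈ algebraicClasses X 2)
    (hMk : Markman2024_rationalHodgeIsometry_algebraic_marked) (hQ : QInvAlgebraic) :
    Summit.HodgeConjecture.HodgeConjecture.Theses.MarkmanPartnerTransport.IsometrySpannedThird :=
  isometrySpannedThird_of_graphClasses_of_dualClass hV hcup hqd fun X hX hK φ P z hM =>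
    graphClasses_of_kappaClasses hM (kappaClasses_of_qInvAlgebraic hQ hMk hcup X hX hK φ P z hM)

/-- **W-QX3 — item #3 `IsometrySpannedThird` of route MarkmanPartnerTransport, BY NAME and at every Picard rank,
from the THREE named facts {Verbitsky–Guan, Charles–Markman 2013, Markman 2024}**: the weak O'Grady clause is
`dualBBFClass_mem_algebraicClasses_of_lefschetzStandard hV hB`, `QInvAlgebraic` is `qInvAlgebraic_of_charlesMarkman hV hB`,
and the multiplicativity of algebraic classes is the tree theorem `Theorems.Voisin2003_cupProduct_algebraicClasses_holds`.
CONDITIONAL on the three facts; credits nothing; nothing here says HC is proved.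
[cite: CharlesMarkman2013, Thm. 1.1 (§1)] [cite: Markman2024, Thm. 1.1 (§1.1)]
[cite: OGrady2008NumericalK3Square, §3 proof of Prop. 3.2 item (6)] -/
theorem isometrySpannedThird_of_three_facts
    (hV : VerbitskyGuan_cohomology_K3HilbertSquareType) (hB : CharlesMarkman2013_lefschetzStandard_K3HilbertType)
    (hMk : Markman2024_rationalHodgeIsometry_algebraic_marked) :
    Summit.HodgeConjecture.HodgeConjecture.Theses.MarkmanPartnerTransport.IsometrySpannedThird :=
  isometrySpannedThird_of_qInvAlgebraic_of_dualClass hV Theorems.Voisin2003_cupProduct_algebraicClasses_holds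
    (fun _ hX hK _ _ _ hM => dualBBFClass_mem_algebraicClasses_of_lefschetzStandard hV hB hX hK hM) hMk
    (qInvAlgebraic_of_charlesMarkman hV hB)

end Summit.HodgeConjecture.HodgeConjecture.Theorems.MarkmanPartnerTransport.PartnerLattice

end
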